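import Literature.Barriers.CriticalPhenomena.PositionSpaceRGNonGibbsianProofs
import Literature.Probability.LatticeModels.GibbsSpecificationProofs
import HarnessLib

/-!
# Barrier `PositionSpaceRGNonGibbsian`, Theorem 4.3 (decimation with spacing `b ≥ 2`): the proof
# architecture — reduction to the uniform finite-volume Griffiths–Pearce–Israel estimate

Second companion file of `Literature/Barriers/CriticalPhenomena/PositionSpaceRGNonGibbsian.lean`,
for the named fact `NonGibbs.VEFS1993_thm43` (van Enter–Fernández–Sokal 1993, Theorem 4.3:
for `d ≥ 2`, `b ≥ 2` and `J` large, the decimation `μT_b` of every zero-field Ising Gibbs measure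
is consistent with no quasilocal specification). The first companion file
(`PositionSpaceRGNonGibbsianProofs.lean`) reduced Theorem 4.2 (`b = 2`, `d ≥ 3`) to the
essential-discontinuity estimate (4.32). Here Theorem 4.3 is reduced further, past (4.32), to a
statement about FINITE-VOLUME nearest-neighbour Ising measures with boundary conditions — the
uniform estimate that Steps 1–3 of the Griffiths–Pearce–Israel argument deliver — so that the
"Step 0" of the printed proof (conditional probabilities of `μT` via conditioning on an infinite
set of spins, Proposition 2.25) is replaced by a proved DLR computation. Nothing is asserted: the
only unproved ingredient, and the only named fact of this file, is `VEFS1993_eq413_spacing : Prop`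
(the estimate (4.32) for spacing `b` is the explicit conclusion of the proved transfer theorem
`VEFS1993_eq432_spacing_of_eq413`, not a named fact of its own).

## What the source prints (arXiv:hep-lat/9210032; equation/section numbers of the paper)

* §4.3.2 (p. 112–113): "The conclusions of Theorem 4.2 for decimation with spacing `b = 2` hold
  also for larger spacings. The main difference from the `b = 2` case is that for `b ≥ 3` the
  system of internal spins obtained with `ω' = ω'_alt` is no longer simply a periodically diluted
  Ising model in zero magnetic field; rather, it contains a periodic alternating magnetic field
  which is nonzero at the sites neighboring an image spin. As a consequence, we need a more
  sophisticated technique to conclude that there is indeed a phase transition (Step 1). The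
  appropriate tool for this purpose is Pirogov–Sinai theory …, which is summarized in
  Appendix B. … one can show that for the fully alternating block-spin configuration, the system
  of internal spins has only two periodic ground states … and that these ground states satisfy
  the Peierls condition. It follows from P–S theory that at low temperature there are precisely
  two periodic Gibbs measures, `μ₊` and `μ₋` … (Section B.5.3). Steps 2 and 3 are then proven in
  a manner exactly identical to the `b = 2` case. … We have thus proven the following:
  **Theorem 4.3** Let `d ≥ 2` and `b ≥ 2`. Then for all `J` sufficiently large (depending on `d`
  and `b`), the following holds: Let `μ` be any Gibbs measure for the `d`-dimensional Ising model
  with nearest-neighbor coupling `J` and zero magnetic field. Let `T` be the decimation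
  transformation with spacing `b`. Then the measure `μT` is not consistent with any quasilocal
  specification."
* §4.2, Step 2 (p. 105), the finite-volume form of the estimate: "since we know only that the
  conditional distribution is some Gibbs measure for the internal-spin system, we need to prove
  the claimed bounds on `μ(f)` uniformly for all Gibbs measures for this system. To do this, it
  suffices to show that the bounds are satisfied for a finite-volume internal-spin system, for
  some sufficiently large volume, uniformly in the (internal-spin) boundary conditions; that is,
  it suffices to show that there exists `R'' < ∞` such that the Gibbs measure for the
  internal-spin system in the volume `Λ^int_{R''}`, with image spins `ω' ∈ 𝒩_{R,R',+}` (or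
  `𝒩_{R,R',-}`) and arbitrary internal-spin boundary condition …, satisfies the claimed bounds.
  For simplicity we shall take `R'' = R'`." §4.3.1 Step 2, eqs. (4.26)–(4.27) (p. 109): "for
  `J` sufficiently large, there exists `c > 0` such that for all `R > 0` there exists `R' > R`
  (depending on `R`) such that `⟨σ_i⟩^{±,+,σ}_{R,R'} ≥ ⟨σ_i⟩^{±,+,-}_{R,R'} ≥ c > 0` (4.26) and by
  symmetry `⟨σ_i⟩^{±,-,σ}_{R,R'} ≤ ⟨σ_i⟩^{±,-,+}_{R,R'} ≤ -c < 0` (4.27) for every configuration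
  `σ` outside `Λ_{R'}` and every `i ∈ Λ^int_R`" (here `±` is the alternating configuration of the
  image spins in `Λ^image_R`, `+`/`-` that of the image spins in the annulus `Λ^image_{R'} ∖
  Λ^image_R`, and `σ` the arbitrary configuration of all spins outside `Λ_{R'}`); Step 3 (p. 112): "we can 'unfix' the spin at the origin in the same way as in
  the 2-dimensional example", i.e. §4.1.2 Step 3, eqs. (4.7)–(4.13) (pp. 99–100), for "the system
  consisting of the internal spins in `Λ_{R+2}` and the spin at the origin, with the image spins
  in `Λ^image_R` other than the one at the origin fixed in the alternating configuration `ω'_alt`,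
  the image spins in layer `Γ^image_{R+2}` set to be `+`, and the spins outside `Λ_{R+2}` (both
  image and internal) fixed in some arbitrary configuration", concluding
  "`⟨σ_{0,0}⟩^ξ_+ - ⟨σ_{0,0}⟩^ξ_- ≥ δ > 0` (4.13) uniformly in `R` (sufficiently large) and in the
  configuration outside".
* §4.1.2 Step 0 (pp. 93–94): the conditional probabilities `E_{μT}(f | {σ'_j}_{j ∈ Λ'ᶜ})` "are
  just the conditional probabilities `E_μ(f | {σ_l}_{l ∈ 2(Λ'ᶜ)})`"; "we use the only fact we know
  about the measure `μ`, namely that it satisfies the DLR equations"; "we shall have to prove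
  bounds which are valid uniformly for all Gibbs measures of the restricted interaction".
* Conclusion of the argument, (4.32) (p. 112) and (4.14) (p. 101): "in every neighborhood of
  `ω'_alt` there are open sets `𝒩₊, 𝒩₋` such that
  `E_{μT}(σ'_0 | {σ'_i}_{i≠0})(ω₁) - E_{μT}(σ'_0 | {σ'_i}_{i≠0})(ω₂) ≥ δ > 0` for `ω₁ ∈ 𝒩₊` and
  `ω₂ ∈ 𝒩₋` … this implies the non-quasilocality of the renormalized measure `μT`, for any
  original Gibbs measure `μ`."

## What is formalised (namespace `Literature.Barriers.CriticalPhenomena.NonGibbs`)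

* Named fact (not proved): `VEFS1993_eq413_spacing` — the outcome of Steps 1–3 of §4.3.2 in the
  finite-volume uniform form of §4.2 Step 2 / (4.26)–(4.27) / (4.13): for `d ≥ 2`, `b ≥ 2`,
  `β > J₀(d,b)` there is `δ > 0` such that for every `R` there are `R' > R`, a finite volume `W`
  of original spins containing the origin and no other image site `bx`, and levels
  `c₊ - c₋ ≥ δ`, with `⟨σ_0⟩^η_{W;β,0} ≥ c₊` for EVERY boundary condition `η` whose image `Tη`
  lies in `𝒩_{R,R',+}` and `≤ c₋` whenever `Tη ∈ 𝒩_{R,R',-}`.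
* PROVED transfer `VEFS1993_eq432_spacing_of_eq413` — the estimate (4.32) for spacing `b`, stated
  in full as the conclusion of a theorem with hypothesis `VEFS1993_eq413_spacing` (DLR equations of
  `μ` in the volume `W` with the `𝓕_{Wᶜ}`-event `T⁻¹B`, properness, and the change of variables
  `ω = Tη`; this replaces the printed Step 0). The estimate (4.32) for spacing `b` is NOT a separate
  named fact: it carries no proof content beyond `VEFS1993_eq413_spacing` and this transfer, so it
  is kept only as the explicit statement of `VEFS1993_eq432_spacing_of_eq413` (and as the
  hypothesis of `VEFS1993_thm43_of_eq432_spacing`).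
* PROVED: `not_isQuasilocalMeasure_of_gap` (the "conclusion of the argument" as a general
  principle: a.e. two-sided gaps of `E_ν(σ'_0 | {σ'_x}_{x≠0})` on charged sets shrinking to `ω'_alt`
  exclude every Feller specification), its specialisation to decimated Ising Gibbs measures
  `not_isQuasilocalMeasure_map_decimate_of_gap`, `VEFS1993_thm43_of_eq432_spacing`, and the
  assembly `VEFS1993_thm43_of_eq413 : VEFS1993_eq413_spacing → VEFS1993_thm43`.
* Supporting lemmas: DLR equations for bounded observables and for outside events
  (`IsGibbsMeasure.integral_eq_integral_kernel`, `IsGibbsMeasure.setIntegral_eq_of_outside`), an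
  a.e. lower/upper bound on a conditional expectation from set-integral bounds
  (`ae_le_condExp_of_setIntegral`, `ae_condExp_le_of_setIntegral`), cylinders under decimation with
  spacing `b` and the positivity of `𝒩_{R,R',±}` under `μT_b`, and the independence of
  `⟨σ_0⟩^η_W` from `η_0` when `0 ∈ W`.

What remains for `VEFS1993_thm43_holds` is exactly `VEFS1993_eq413_spacing` (Pirogov–Sinai theory
for the internal-spin system, App. B.5.3; FKG/Griffiths phase selection; unfixing). Downstream
files reduce it further: `…Extremal.lean` (FKG: the two extremal boundary conditions suffice) and
`…SpacingSelection.lean` (screening, Steps 2.1–2.2, proved in `…SpacingSelectionProofs.lean`; and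
the plus phase of the alternating internal-spin system, Steps 1, 2.3–2.4, 3 — the Pirogov–Sinai
content of App. B.5.3 with Theorems B.27–B.28, which is the one open leaf of the Theorem 4.3 line).
-/

noncomputable section

namespace Literature.Barriers.CriticalPhenomena.NonGibbs

open MeasureTheory ProbabilityTheory Filter Literature.Probability.LatticeModels
open scoped ENNReal ProbabilityTheory BoundedContinuousFunction
open _root_.Topology

/-! ### DLR equations for bounded observables and outside events -/

section Specification

variable {V S : Type*} [MeasurableSpace S] {γ : Specification V S}

/-- **DLR equations for bounded observables** (van Enter–Fernández–Sokal Proposition 2.7 (c),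
`μ = μπ_Λ`, applied to a bounded measurable `F`): `∫ F dν = ∫ (π_Λ F)(η) dν(η)`.
[cite: VanenterFernandezSokal1993, Proposition 2.7 (c)] -/
theorem _root_.Literature.Probability.LatticeModels.IsGibbsMeasure.integral_eq_integral_kernel
    (hγ : IsSpecification γ) {ν : Measure (V → S)} (hν : IsGibbsMeasure γ ν) (Λ : Finset V)
    {F : (V → S) → ℝ} (hF : Measurable F) {C : ℝ} (hC : ∀ σ, ‖F σ‖ ≤ C) :
    ∫ σ, F σ ∂ν = ∫ η, ∫ σ, F σ ∂(γ Λ η) ∂ν := by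
  haveI := hν.isProbabilityMeasure
  haveI := hγ.isMarkovKernel_piKernel Λ
  have hcomp : (hγ.piKernel Λ ∘ₖ Kernel.const Unit ν) () = ν := by
    rw [Kernel.comp_apply, Kernel.const_apply]
    exact hν.comp_piKernel hγ Λ
  have hFi : Integrable F ((hγ.piKernel Λ ∘ₖ Kernel.const Unit ν) ()) := by
    rw [hcomp]
    exact (integrable_const C).mono' hF.aestronglyMeasurable (ae_of_all _ hC)
  have := Kernel.integral_comp hFi
  rwa [hcomp, Kernel.const_apply] at this

/-- **DLR equations localised to an outside event** (van Enter–Fernández–Sokal Definition 2.6 /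
Proposition 2.7 with properness, Definition 2.5 (b)): for `s ∈ 𝓕_{Λᶜ}` and bounded measurable `f`,
`∫_s f dν = ∫_s (π_Λ f)(η) dν(η)`. This is the computation behind §4.1.2 Step 0 ("we use the
only fact we know about the measure `μ`, namely that it satisfies the DLR equations").
[cite: VanenterFernandezSokal1993, Proposition 2.7 (c) and Definition 2.5 (b)] -/
theorem _root_.Literature.Probability.LatticeModels.IsGibbsMeasure.setIntegral_eq_of_outside
    (hγ : IsSpecification γ) {ν : Measure (V → S)} (hν : IsGibbsMeasure γ ν) (Λ : Finset V)
    {s : Set (V → S)} (hs : MeasurableSet[cylinderEvents (X := fun _ : V => S) ((↑Λ : Set V)ᶜ)] s)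
    {f : (V → S) → ℝ} (hf : Measurable f) {C : ℝ} (hC : ∀ σ, ‖f σ‖ ≤ C) :
    ∫ σ in s, f σ ∂ν = ∫ η in s, (∫ σ, f σ ∂(γ Λ η)) ∂ν := by
  have hs' : MeasurableSet s := cylinderEvents_le_pi _ hs
  have hb : ∀ σ, ‖s.indicator f σ‖ ≤ C := fun σ =>
    (norm_indicator_le_norm_self f σ).trans (hC σ)
  calc ∫ σ in s, f σ ∂ν = ∫ σ, s.indicator f σ ∂ν := (integral_indicator hs').symm
    _ = ∫ η, ∫ σ, s.indicator f σ ∂(γ Λ η) ∂ν :=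
        hν.integral_eq_integral_kernel hγ Λ (hf.indicator hs') hb
    _ = ∫ η, s.indicator (fun η => ∫ σ, f σ ∂(γ Λ η)) η ∂ν :=
        integral_congr_ae (ae_of_all _ fun η => hγ.integral_indicator_eq Λ hs f η)
    _ = ∫ η in s, (∫ σ, f σ ∂(γ Λ η)) ∂ν := integral_indicator hs'

end Specification

/-! ### A.e. bounds on a conditional expectation from set-integral bounds -/

section CondExp

variable {Ω : Type*} {m m₀ : MeasurableSpace Ω} {ν : Measure Ω}

/-- If `c ν(B) ≤ ∫_B f dν` for every `B ∈ m` inside the `m`-measurable set `A`, then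
`E_ν(f | m) ≥ c` `ν`-a.e. on `A` (conditional expectations as an a.e. class: "no modification on a
set of measure zero" can evade the bound, van Enter–Fernández–Sokal §4.1.2 Step 0 / p. 101);
standard measure theory. [folklore] -/
theorem ae_le_condExp_of_setIntegral (hm : m ≤ m₀) [IsFiniteMeasure ν] {f : Ω → ℝ}
    (hf : Integrable f ν) {A : Set Ω} (hA : MeasurableSet[m] A) (c : ℝ)
    (h : ∀ B : Set Ω, MeasurableSet[m] B → B ⊆ A → c * ν.real B ≤ ∫ x in B, f x ∂ν) :
    ∀ᵐ x ∂ν, x ∈ A → c ≤ (ν[f|m]) x := by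
  have hCEm : StronglyMeasurable[m] (ν[f|m]) := stronglyMeasurable_condExp
  set B : Set Ω := (ν[f|m]) ⁻¹' Set.Iio c ∩ A with hBdef
  have hBm : MeasurableSet[m] B := (hCEm.measurable measurableSet_Iio).inter hA
  have hB : MeasurableSet B := hm _ hBm
  -- it suffices that `B = {E(f|m) < c} ∩ A` is null
  suffices hnull : ν B = 0 by
    have : ∀ᵐ x ∂ν, x ∉ B := measure_eq_zero_iff_ae_notMem.1 hnull
    filter_upwards [this] with x hx hxA
    by_contra hlt
    exact hx ⟨not_le.1 hlt, hxA⟩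
  by_contra hne
  have hpos : 0 < ν B := pos_iff_ne_zero.2 hne
  -- on `B` the integrand `c - E(f|m)` is positive, so its integral over `B` is positive
  have hgi : IntegrableOn (fun x => c - (ν[f|m]) x) B ν :=
    ((integrable_const c).sub integrable_condExp).integrableOn
  have hg_nonneg : 0 ≤ᵐ[ν.restrict B] fun x => c - (ν[f|m]) x :=
    ae_restrict_of_forall_mem hB fun x hx => sub_nonneg.2 (le_of_lt hx.1)
  have hsupp : Function.support (fun x => c - (ν[f|m]) x) ∩ B = B :=
    Set.inter_eq_right.2 fun x hx => Function.mem_support.2 (sub_pos.2 hx.1).ne'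
  have hint_pos : 0 < ∫ x in B, (c - (ν[f|m]) x) ∂ν := by
    rw [setIntegral_pos_iff_support_of_nonneg_ae hg_nonneg hgi, hsupp]
    exact hpos
  -- but by hypothesis and `∫_B E(f|m) = ∫_B f` it is nonpositive
  have hsub : ∫ x in B, (c - (ν[f|m]) x) ∂ν = c * ν.real B - ∫ x in B, f x ∂ν := by
    rw [integral_sub (integrable_const c).integrableOn integrable_condExp.integrableOn,
      setIntegral_const, smul_eq_mul, mul_comm, setIntegral_condExp hm hf hBm]
  have := h B hBm Set.inter_subset_right
  linarith

/-- Upper-bound version of `ae_le_condExp_of_setIntegral`: if `∫_B f dν ≤ c ν(B)` for every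
`B ∈ m` inside `A ∈ m`, then `E_ν(f | m) ≤ c` `ν`-a.e. on `A`; standard measure theory. [folklore] -/
theorem ae_condExp_le_of_setIntegral (hm : m ≤ m₀) [IsFiniteMeasure ν] {f : Ω → ℝ}
    (hf : Integrable f ν) {A : Set Ω} (hA : MeasurableSet[m] A) (c : ℝ)
    (h : ∀ B : Set Ω, MeasurableSet[m] B → B ⊆ A → ∫ x in B, f x ∂ν ≤ c * ν.real B) :
    ∀ᵐ x ∂ν, x ∈ A → (ν[f|m]) x ≤ c := by
  have hneg : ∀ B : Set Ω, MeasurableSet[m] B → B ⊆ A →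
      (-c) * ν.real B ≤ ∫ x in B, (-f) x ∂ν := fun B hB hBA => by
    simp only [Pi.neg_apply, integral_neg, neg_mul]
    exact neg_le_neg (h B hB hBA)
  filter_upwards [ae_le_condExp_of_setIntegral hm hf.neg hA (-c) hneg, condExp_neg f m]
    with x hx hxneg hxA
  have := hx hxA
  rw [hxneg, Pi.neg_apply] at this
  linarith

end CondExp

/-! ### Decimation with spacing `b`: cylinders, positivity, the image σ-algebra off the origin -/

section Spacing

variable {d : ℕ}

/-- Decimation fixes the spin at the origin: `(T_b σ)_0 = σ_0`.
[cite: VanenterFernandezSokal1993, §3.1.2 Example 1, eq. (3.7)] -/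
@[simp] theorem decimate_apply_zero (b : ℕ) (σ : SpinConfig (Site d)) :
    decimate d b σ 0 = σ 0 := by
  have h0 : (fun i => (b : ℤ) * (0 : Site d) i) = 0 := funext fun i => by simp
  rw [decimate_apply, h0]

/-- `σ'_0 ∘ T_b = σ_0` as real observables. [cite: VanenterFernandezSokal1993, §3.1.2 eq. (3.7)] -/
theorem spinAt_zero_decimate (b : ℕ) (σ : SpinConfig (Site d)) :
    spinAt 0 (decimate d b σ) = spinAt 0 σ := by
  unfold spinAt
  rw [decimate_apply_zero]

/-- The decimation preimage of a cylinder on the image lattice contains a cylinder on the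
original lattice, on the dilated sites `bΛ'` (spacing `b ≥ 1`).
[cite: VanenterFernandezSokal1993, §4.1.2 Step 0] -/
theorem cylinder_subset_preimage_decimate_spacing {b : ℕ} (hb : 0 < b) (Λ' : Finset (Site d))
    (s : SpinConfig (Site d)) :
    {σ : SpinConfig (Site d) | ∀ y ∈ Λ'.image (fun x : Site d => fun i => (b : ℤ) * x i),
        σ y = s (fun i => y i / b)} ⊆
      decimate d b ⁻¹' {ω | ∀ x ∈ Λ', ω x = s x} := by
  intro σ hσ x hx
  have hy : (fun i => (b : ℤ) * x i) ∈ Λ'.image (fun x : Site d => fun i => (b : ℤ) * x i) :=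
    Finset.mem_image_of_mem _ hx
  have := hσ _ hy
  simp only [decimate_apply]
  rw [this]
  congr 1
  funext i
  exact Int.mul_ediv_cancel_left _ (by exact_mod_cast hb.ne')

/-- **"Open sets … have strictly positive `(μT)`-measure"** for `𝒩_{R,R',+}` and spacing `b ≥ 1`:
the decimated image `μT_b` of an Ising Gibbs measure charges `𝒩_{R,R',+}` (finite energy of `μ`
on the cylinder of original spins `σ_{bx}`, `x ∈ Λ_{R'}`).
[cite: VanenterFernandezSokal1993, §4.1.2 Conclusion of the argument] -/
theorem map_decimate_plusSelected_pos_spacing {b : ℕ} (hb : 0 < b) {β h : ℝ}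
    {μ : Measure (SpinConfig (Site d))} (hμ : μ ∈ isingGibbsMeasures d β h) (R R' : ℕ) :
    0 < μ.map (decimate d b) (plusSelected d R R') := by
  classical
  set s : SpinConfig (Site d) := fun x => if x ∈ box d R then altConfig d x else 1 with hs
  have hsub : {ω : SpinConfig (Site d) | ∀ x ∈ box d R ∪ box d R', ω x = s x} ⊆
      plusSelected d R R' := by
    intro ω hω
    refine ⟨fun x hx => ?_, fun x hx hxR => ?_⟩
    · rw [hω x (Finset.mem_union_left _ hx), hs]; simp [hx]
    · rw [hω x (Finset.mem_union_right _ hx), hs]; simp [hxR]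
  refine lt_of_lt_of_le ?_ (Measure.le_map_apply (measurable_decimate d b).aemeasurable _)
  refine lt_of_lt_of_le ?_ (measure_mono (Set.preimage_mono hsub))
  refine lt_of_lt_of_le ?_ (measure_mono (cylinder_subset_preimage_decimate_spacing hb _ s))
  exact measure_cylinder_pos_of_mem_isingGibbsMeasures hμ _ _

/-- Positivity of `𝒩_{R,R',-}` under `μT_b` (as for `𝒩_{R,R',+}`).
[cite: VanenterFernandezSokal1993, §4.1.2 Conclusion of the argument] -/
theorem map_decimate_minusSelected_pos_spacing {b : ℕ} (hb : 0 < b) {β h : ℝ}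
    {μ : Measure (SpinConfig (Site d))} (hμ : μ ∈ isingGibbsMeasures d β h) (R R' : ℕ) :
    0 < μ.map (decimate d b) (minusSelected d R R') := by
  classical
  set s : SpinConfig (Site d) := fun x => if x ∈ box d R then altConfig d x else -1 with hs
  have hsub : {ω : SpinConfig (Site d) | ∀ x ∈ box d R ∪ box d R', ω x = s x} ⊆
      minusSelected d R R' := by
    intro ω hω
    refine ⟨fun x hx => ?_, fun x hx hxR => ?_⟩
    · rw [hω x (Finset.mem_union_left _ hx), hs]; simp [hx]
    · rw [hω x (Finset.mem_union_right _ hx), hs]; simp [hxR]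
  refine lt_of_lt_of_le ?_ (Measure.le_map_apply (measurable_decimate d b).aemeasurable _)
  refine lt_of_lt_of_le ?_ (measure_mono (Set.preimage_mono hsub))
  refine lt_of_lt_of_le ?_ (measure_mono (cylinder_subset_preimage_decimate_spacing hb _ s))
  exact measure_cylinder_pos_of_mem_isingGibbsMeasures hμ _ _

/-- For a finite volume `W` containing no image site `bx`, `x ≠ 0`, decimation is measurable from
the outside σ-algebra `𝓕_{Wᶜ}` of the original system to the σ-algebra `𝓕'_{{0}ᶜ}` of image events
not involving the origin: conditioning `μT` on `{σ'_x}_{x≠0}` is conditioning `μ` on the spins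
`σ_{bx}`, `x ≠ 0`, all of which lie outside `W` (van Enter–Fernández–Sokal §4.1.2 Step 0: "these
are just the conditional probabilities `E_μ(f | {σ_l}_{l ∈ 2(Λ'ᶜ)})`").
[cite: VanenterFernandezSokal1993, §4.1.2 Step 0] -/
theorem measurable_decimate_outside {b : ℕ} (W : Finset (Site d))
    (hW : ∀ x : Site d, x ≠ 0 → (fun i => (b : ℤ) * x i) ∉ W) :
    @Measurable _ _ (cylinderEvents (X := fun _ : Site d => ℤˣ) ((↑W : Set (Site d))ᶜ))
      (cylinderEvents (X := fun _ : Site d => ℤˣ) ((↑({0} : Finset (Site d)) : Set (Site d))ᶜ))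
      (decimate d b) := by
  rw [measurable_cylinderEvents_iff]
  intro x hx
  have hx0 : x ≠ 0 := by simpa using hx
  simp only [decimate_apply]
  exact measurable_cylinderEvent_apply (X := fun _ : Site d => ℤˣ) (i := fun i => (b : ℤ) * x i)
    (by simpa using hW x hx0)

end Spacing

/-! ### The finite-volume expectation `⟨σ_0⟩^η_W` does not read `η` inside `W` -/

section Kernel

variable {d : ℕ}

/-- The finite-volume Ising measures with boundary conditions agreeing off `W` coincide (the
kernel `γ_W(· | η)` reads `η` only outside `W`). [cite: FriedliVelenik2017, §3.1 and Lemma 6.7] -/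
theorem isingMeasure_fixed_eq_of_eqOn_compl (W : Finset (Site d)) (β h : ℝ)
    {ζ ζ' : SpinConfig (Site d)} (hζ : ∀ x ∉ W, ζ x = ζ' x) :
    isingMeasure (zdGraph d) W β h (.fixed ζ) = isingMeasure (zdGraph d) W β h (.fixed ζ') :=
  Measure.ext fun _ hA => isingMeasure_fixed_congr_of_eqOn_compl (zdGraph d) W β h hζ hA

/-- In particular `⟨σ_0⟩^η_{W;β,h}` does not depend on `η_0` when `0 ∈ W` (the image spin at the
origin is "unfixed", van Enter–Fernández–Sokal §4.1.2 Step 3).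
[cite: VanenterFernandezSokal1993, §4.1.2 Step 3] -/
theorem isingExpect_fixed_update_of_mem (W : Finset (Site d)) (β h : ℝ) {x : Site d} (hx : x ∈ W)
    (η : SpinConfig (Site d)) (u : ℤˣ) (f : SpinConfig (Site d) → ℝ) :
    isingExpect (zdGraph d) W β h (.fixed (Function.update η x u)) f =
      isingExpect (zdGraph d) W β h (.fixed η) f := by
  unfold isingExpect
  rw [isingMeasure_fixed_eq_of_eqOn_compl W β h (ζ := Function.update η x u) (ζ' := η)]
  intro y hy
  have : y ≠ x := fun h => hy (h ▸ hx)
  simp [Function.update_of_ne this]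

end Kernel

/-! ### The named fact: the uniform finite-volume Griffiths–Pearce–Israel estimate for spacing `b`
(Steps 1–3 of §4.3.2, in the finite-volume form of §4.2 Step 2 / (4.26)–(4.27) / (4.13)) — the
only named fact of this file -/

section Facts

/-- **van Enter–Fernández–Sokal 1993, §4.3.2 Steps 1–3 for decimation with spacing `b` — the
uniform finite-volume estimate behind Theorem 4.3** (eqs. (4.26)–(4.27) of §4.3.1 combined with
the unfixing Step 3, eqs. (4.7)–(4.13) of §4.1.2, in the finite-volume uniform form prescribed in
§4.2 Step 2: "it suffices to show that there exists `R'' < ∞` such that the Gibbs measure for the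
internal-spin system in the volume `Λ^int_{R''}`, with image spins `ω' ∈ 𝒩_{R,R',+}` (or
`𝒩_{R,R',-}`) and arbitrary internal-spin boundary condition … satisfies the claimed bounds").
For `d ≥ 2` and `b ≥ 2` there is `J₀ = J₀(d, b)` such that for every `β > J₀` there is `δ > 0`
with: for every `R` there are `R' > R`, a finite set `W` of original sites containing the origin
and no other image site `bx` (`x ≠ 0`) — in the source, the internal spins of the cube `Λ_{R'}`
together with the spin at the origin — and levels `c₊`, `c₋` with `c₊ - c₋ ≥ δ`, such that the
finite-volume zero-field Ising expectation of the spin at the origin in `W` satisfies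
`⟨σ_0⟩^η_{W;β,0} ≥ c₊` for EVERY boundary condition `η` whose decimation `T_b η` lies in
`𝒩_{R,R',+}` (image spins alternating on `Λ_R`, `+` on `Λ_{R'} ∖ Λ_R`, everything else — image
spins outside `Λ_{R'}` and all internal spins — arbitrary), and `⟨σ_0⟩^η_{W;β,0} ≤ c₋` whenever
`T_b η ∈ 𝒩_{R,R',-}` ("(4.13) uniformly in `R` … and in the configuration outside"; (4.26):
"for `J` sufficiently large, there exists `c > 0` such that for all `R > 0` there exists `R' > R`
(depending on `R`)"). Printed proof: Step 1, phase transition of the internal-spin system at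
`ω'_alt` by Pirogov–Sinai theory (Appendix B, §B.5.3; for `b = 2` a periodically diluted
ferromagnet, §4.3.1 Step 1); Step 2, phase selection by the `±` image spins in the annulus
(Steps 2.1–2.4 of §4.3.1: weak limits, uniqueness for `+` image spins, FKG comparison,
spontaneous magnetisation); Step 3, unfixing of the origin. Named fact, not proved here.
[cite: VanenterFernandezSokal1993, §4.3.2 with §4.3.1 eqs. (4.26)–(4.27), §4.1.2 eq. (4.13), §4.2 Step 2] -/
def VEFS1993_eq413_spacing : Prop :=
  ∀ d b : ℕ, 2 ≤ d → 2 ≤ b → ∃ J₀ : ℝ, ∀ β : ℝ, J₀ < β → ∃ δ : ℝ, 0 < δ ∧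
    ∀ R : ℕ, ∃ R' : ℕ, R < R' ∧ ∃ W : Finset (Site d), (0 : Site d) ∈ W ∧
      (∀ x : Site d, x ≠ 0 → (fun i => (b : ℤ) * x i) ∉ W) ∧
      ∃ cplus cminus : ℝ, δ ≤ cplus - cminus ∧
        (∀ η : SpinConfig (Site d), decimate d b η ∈ plusSelected d R R' →
          cplus ≤ isingExpect (zdGraph d) W β 0 (.fixed η) (spinAt 0)) ∧
        (∀ η : SpinConfig (Site d), decimate d b η ∈ minusSelected d R R' →
          isingExpect (zdGraph d) W β 0 (.fixed η) (spinAt 0) ≤ cminus)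

end Facts

/-! ### Transfer: uniform finite-volume bounds give a.e. bounds on `E_{μT}(σ'_0 | {σ'_x}_{x≠0})`
(the printed Step 0 replaced by the DLR equations in the volume `W`) -/

section Transfer

variable {d : ℕ}

/-- **Change of variables and DLR in the volume `W`.** For an Ising Gibbs measure `μ`, spacing
`b ≥ 1`, a finite volume `W` free of image sites `bx` (`x ≠ 0`), and an image event `B` not
involving the origin: `∫_B σ'_0 dμT_b = ∫_{T⁻¹B} ⟨σ_0⟩^η_{W;β,h} dμ(η)` — the conditional
probabilities of the image system computed from the DLR equations of the original one
(van Enter–Fernández–Sokal §4.1.2 Step 0). [cite: VanenterFernandezSokal1993, §4.1.2 Step 0] -/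
theorem setIntegral_spinAt_map_decimate {b : ℕ} {β h : ℝ} {μ : Measure (SpinConfig (Site d))}
    (hμ : μ ∈ isingGibbsMeasures d β h) (W : Finset (Site d))
    (hW : ∀ x : Site d, x ≠ 0 → (fun i => (b : ℤ) * x i) ∉ W) {B : Set (SpinConfig (Site d))}
    (hB : MeasurableSet[cylinderEvents (X := fun _ : Site d => ℤˣ)
      ((↑({0} : Finset (Site d)) : Set (Site d))ᶜ)] B) :
    ∫ ω in B, spinAt 0 ω ∂(μ.map (decimate d b)) =
      ∫ η in decimate d b ⁻¹' B, isingExpect (zdGraph d) W β h (.fixed η) (spinAt 0) ∂μ := by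
  rw [mem_isingGibbsMeasures_iff] at hμ
  have hγ : IsSpecification (isingSpecification (zdGraph d) β h) :=
    isSpecification_isingSpecification_zd_holds d β h
  have hBm : MeasurableSet B := cylinderEvents_le_pi _ hB
  have hpreW : MeasurableSet[cylinderEvents (X := fun _ : Site d => ℤˣ) ((↑W : Set (Site d))ᶜ)]
      (decimate d b ⁻¹' B) :=
    measurable_decimate_outside W hW hB
  have hpre : MeasurableSet (decimate d b ⁻¹' B) := cylinderEvents_le_pi _ hpreW
  -- change of variables `ω = Tη`, using `σ'_0 ∘ T = σ_0`
  have hcv : ∫ ω in B, spinAt 0 ω ∂(μ.map (decimate d b)) =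
      ∫ η in decimate d b ⁻¹' B, spinAt 0 η ∂μ := by
    have hcomp : spinAt (0 : Site d) ∘ decimate d b = spinAt 0 :=
      funext fun η => spinAt_zero_decimate b η
    rw [← integral_indicator hBm, ← integral_indicator hpre,
      integral_map (measurable_decimate d b).aemeasurable
        ((measurable_spinAt 0).indicator hBm).aestronglyMeasurable]
    refine integral_congr_ae (ae_of_all _ fun η => ?_)
    calc B.indicator (spinAt 0) (decimate d b η)
        = (decimate d b ⁻¹' B).indicator (spinAt 0 ∘ decimate d b) η :=
          (Set.indicator_comp_right _).symm
      _ = (decimate d b ⁻¹' B).indicator (spinAt 0) η := by rw [hcomp]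
  rw [hcv]
  -- DLR equations of `μ` in `W`, localised to the `𝓕_{Wᶜ}`-event `T⁻¹B`
  exact hμ.setIntegral_eq_of_outside hγ W hpreW (measurable_spinAt 0) (norm_spinAt_le_one 0)

/-- The origin-free version of `𝒩_{R,R',+}`: the image event "`ω' = ω'_alt` on `Λ_R ∖ {0}`, `+1`
on `Λ_{R'} ∖ Λ_R`", an event of `𝓕'_{{0}ᶜ}` containing `𝒩_{R,R',+}`.
[cite: VanenterFernandezSokal1993, eq. (4.25a)] -/
theorem measurableSet_plusSelected_offOrigin (R R' : ℕ) :
    MeasurableSet[cylinderEvents (X := fun _ : Site d => ℤˣ)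
      ((↑({0} : Finset (Site d)) : Set (Site d))ᶜ)]
      {ω : SpinConfig (Site d) | (∀ x ∈ box d R, x ≠ 0 → ω x = altConfig d x) ∧
        ∀ x ∈ box d R', x ∉ box d R → ω x = 1} := by
  have hev : ∀ x : Site d, x ≠ 0 → ∀ u : ℤˣ,
      MeasurableSet[cylinderEvents (X := fun _ : Site d => ℤˣ)
        ((↑({0} : Finset (Site d)) : Set (Site d))ᶜ)] {ω : SpinConfig (Site d) | ω x = u} :=
    fun x hx u => measurable_cylinderEvent_apply (X := fun _ : Site d => ℤˣ) (i := x)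
      (by simpa using hx) (measurableSet_singleton u)
  have h1 : {ω : SpinConfig (Site d) | (∀ x ∈ box d R, x ≠ 0 → ω x = altConfig d x) ∧
      ∀ x ∈ box d R', x ∉ box d R → ω x = 1} =
      (⋂ x ∈ (box d R).filter (fun x => x ≠ 0), {ω : SpinConfig (Site d) | ω x = altConfig d x}) ∩
        ⋂ x ∈ (box d R').filter (fun x => x ∉ box d R), {ω : SpinConfig (Site d) | ω x = 1} := by
    ext ω
    simp only [Set.mem_setOf_eq, Set.mem_inter_iff, Set.mem_iInter, Finset.mem_filter, and_imp]
  rw [h1]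
  refine MeasurableSet.inter ?_ ?_
  · exact Finset.measurableSet_biInter _ fun x hx => hev x (Finset.mem_filter.1 hx).2 _
  · refine Finset.measurableSet_biInter _ fun x hx => hev x ?_ _
    intro h0
    exact (Finset.mem_filter.1 hx).2 (h0 ▸ zero_mem_box d R)

/-- The origin-free version of `𝒩_{R,R',-}` is an event of `𝓕'_{{0}ᶜ}`.
[cite: VanenterFernandezSokal1993, eq. (4.25b)] -/
theorem measurableSet_minusSelected_offOrigin (R R' : ℕ) :
    MeasurableSet[cylinderEvents (X := fun _ : Site d => ℤˣ)
      ((↑({0} : Finset (Site d)) : Set (Site d))ᶜ)]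
      {ω : SpinConfig (Site d) | (∀ x ∈ box d R, x ≠ 0 → ω x = altConfig d x) ∧
        ∀ x ∈ box d R', x ∉ box d R → ω x = -1} := by
  have hev : ∀ x : Site d, x ≠ 0 → ∀ u : ℤˣ,
      MeasurableSet[cylinderEvents (X := fun _ : Site d => ℤˣ)
        ((↑({0} : Finset (Site d)) : Set (Site d))ᶜ)] {ω : SpinConfig (Site d) | ω x = u} :=
    fun x hx u => measurable_cylinderEvent_apply (X := fun _ : Site d => ℤˣ) (i := x)
      (by simpa using hx) (measurableSet_singleton u)
  have h1 : {ω : SpinConfig (Site d) | (∀ x ∈ box d R, x ≠ 0 → ω x = altConfig d x) ∧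
      ∀ x ∈ box d R', x ∉ box d R → ω x = -1} =
      (⋂ x ∈ (box d R).filter (fun x => x ≠ 0), {ω : SpinConfig (Site d) | ω x = altConfig d x}) ∩
        ⋂ x ∈ (box d R').filter (fun x => x ∉ box d R), {ω : SpinConfig (Site d) | ω x = -1} := by
    ext ω
    simp only [Set.mem_setOf_eq, Set.mem_inter_iff, Set.mem_iInter, Finset.mem_filter, and_imp]
  rw [h1]
  refine MeasurableSet.inter ?_ ?_
  · exact Finset.measurableSet_biInter _ fun x hx => hev x (Finset.mem_filter.1 hx).2 _
  · refine Finset.measurableSet_biInter _ fun x hx => hev x ?_ _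
    intro h0
    exact (Finset.mem_filter.1 hx).2 (h0 ▸ zero_mem_box d R)

/-- **Transfer of a uniform finite-volume lower bound** (replacing Step 0 of the printed proof):
if `⟨σ_0⟩^η_{W;β,h} ≥ c` for every boundary condition `η` with `T_b η ∈ 𝒩_{R,R',+}`, where `W ∋ 0`
contains no other image site, then `E_{μT_b}(σ'_0 | {σ'_x}_{x≠0}) ≥ c` `μT_b`-a.e. on `𝒩_{R,R',+}`,
for every Ising Gibbs measure `μ` at `(β, h)`.
[cite: VanenterFernandezSokal1993, §4.1.2 Step 0 and §4.2 Step 2] -/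
theorem ae_le_condExpSpinAtOrigin_of_forall_isingExpect {b : ℕ} (hb : 0 < b) {β h : ℝ}
    {μ : Measure (SpinConfig (Site d))} (hμ : μ ∈ isingGibbsMeasures d β h)
    {W : Finset (Site d)} (h0 : (0 : Site d) ∈ W)
    (hW : ∀ x : Site d, x ≠ 0 → (fun i => (b : ℤ) * x i) ∉ W) {R R' : ℕ} {c : ℝ}
    (hc : ∀ η : SpinConfig (Site d), decimate d b η ∈ plusSelected d R R' →
      c ≤ isingExpect (zdGraph d) W β h (.fixed η) (spinAt 0)) :
    ∀ᵐ ω ∂(μ.map (decimate d b)), ω ∈ plusSelected d R R' →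
      c ≤ condExpSpinAtOrigin d (μ.map (decimate d b)) ω := by
  haveI : IsProbabilityMeasure μ := (mem_isingGibbsMeasures_iff _ _ _ _).1 hμ |>.1
  haveI : IsProbabilityMeasure (μ.map (decimate d b)) :=
    Measure.isProbabilityMeasure_map (measurable_decimate d b).aemeasurable
  set A : Set (SpinConfig (Site d)) :=
    {ω | (∀ x ∈ box d R, x ≠ 0 → ω x = altConfig d x) ∧ ∀ x ∈ box d R', x ∉ box d R → ω x = 1}
    with hAdef
  have hA := measurableSet_plusSelected_offOrigin (d := d) R R'
  -- the bound extends from `T⁻¹𝒩_{R,R',+}` to `T⁻¹A`: `⟨σ_0⟩^η_W` does not read `η_0`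
  have hc' : ∀ η : SpinConfig (Site d), decimate d b η ∈ A →
      c ≤ isingExpect (zdGraph d) W β h (.fixed η) (spinAt 0) := by
    intro η hη
    have hmem : decimate d b (Function.update η 0 1) ∈ plusSelected d R R' := by
      have hoff : ∀ x : Site d, x ≠ 0 →
          decimate d b (Function.update η 0 1) x = decimate d b η x := by
        intro x hx
        simp only [decimate_apply]
        rw [Function.update_of_ne]
        intro hbx
        apply hx
        funext i
        have := congrFun hbx i
        simp only [Pi.zero_apply, mul_eq_zero, Nat.cast_eq_zero] at this
        exact this.resolve_left hb.ne'
      refine ⟨fun x hx => ?_, fun x hx hxR => ?_⟩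
      · by_cases hx0 : x = 0
        · subst hx0
          rw [decimate_apply_zero, Function.update_self, altConfig_zero]
        · rw [hoff x hx0]; exact hη.1 x hx hx0
      · have hx0 : x ≠ 0 := fun h0 => hxR (h0 ▸ zero_mem_box d R)
        rw [hoff x hx0]; exact hη.2 x hx hxR
    have := hc _ hmem
    rwa [isingExpect_fixed_update_of_mem W β h h0] at this
  have hint : Integrable (spinAt (0 : Site d)) (μ.map (decimate d b)) :=
    (integrable_const (1 : ℝ)).mono' (measurable_spinAt 0).aestronglyMeasurable
      (ae_of_all _ (norm_spinAt_le_one 0))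
  have key := ae_le_condExp_of_setIntegral (ν := μ.map (decimate d b)) cylinderEvents_le_pi hint
    hA c (fun B hB hBA => ?_)
  · filter_upwards [key] with ω hω hmem
    exact hω ⟨fun x hx _ => hmem.1 x hx, hmem.2⟩
  -- the set-integral bound on `B ⊆ A`, `B ∈ 𝓕'_{{0}ᶜ}`
  rw [setIntegral_spinAt_map_decimate hμ W hW hB]
  have hpre : MeasurableSet (decimate d b ⁻¹' B) :=
    cylinderEvents_le_pi _ (measurable_decimate_outside W hW hB)
  have hBm : MeasurableSet B := cylinderEvents_le_pi _ hB
  calc c * (μ.map (decimate d b)).real B = c * μ.real (decimate d b ⁻¹' B) := by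
        rw [map_measureReal_apply (measurable_decimate d b) hBm]
    _ = ∫ _ in decimate d b ⁻¹' B, c ∂μ := by rw [setIntegral_const, smul_eq_mul, mul_comm]
    _ ≤ ∫ η in decimate d b ⁻¹' B, isingExpect (zdGraph d) W β h (.fixed η) (spinAt 0) ∂μ := by
        refine setIntegral_mono_on (integrableOn_const (measure_ne_top μ _)) ?_ hpre
          fun η hη => hc' η (hBA hη)
        refine ((integrable_const (1 : ℝ)).mono' ?_ (ae_of_all _ fun η => ?_)).integrableOn
        · exact ((measurable_spinAt 0).stronglyMeasurable.integral_kernel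
            (κ := (isSpecification_isingSpecification_zd_holds d β h).piKernel W)).aestronglyMeasurable
        · unfold isingExpect
          simpa using norm_integral_le_of_norm_le_const (μ := isingMeasure (zdGraph d) W β h (.fixed η))
            (ae_of_all _ (norm_spinAt_le_one 0))

/-- **Transfer of a uniform finite-volume upper bound** on `𝒩_{R,R',-}` (as for the lower bound).
[cite: VanenterFernandezSokal1993, §4.1.2 Step 0 and §4.2 Step 2] -/
theorem ae_condExpSpinAtOrigin_le_of_forall_isingExpect {b : ℕ} (hb : 0 < b) {β h : ℝ}
    {μ : Measure (SpinConfig (Site d))} (hμ : μ ∈ isingGibbsMeasures d β h)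
    {W : Finset (Site d)} (h0 : (0 : Site d) ∈ W)
    (hW : ∀ x : Site d, x ≠ 0 → (fun i => (b : ℤ) * x i) ∉ W) {R R' : ℕ} {c : ℝ}
    (hc : ∀ η : SpinConfig (Site d), decimate d b η ∈ minusSelected d R R' →
      isingExpect (zdGraph d) W β h (.fixed η) (spinAt 0) ≤ c) :
    ∀ᵐ ω ∂(μ.map (decimate d b)), ω ∈ minusSelected d R R' →
      condExpSpinAtOrigin d (μ.map (decimate d b)) ω ≤ c := by
  haveI : IsProbabilityMeasure μ := (mem_isingGibbsMeasures_iff _ _ _ _).1 hμ |>.1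
  haveI : IsProbabilityMeasure (μ.map (decimate d b)) :=
    Measure.isProbabilityMeasure_map (measurable_decimate d b).aemeasurable
  set A : Set (SpinConfig (Site d)) :=
    {ω | (∀ x ∈ box d R, x ≠ 0 → ω x = altConfig d x) ∧ ∀ x ∈ box d R', x ∉ box d R → ω x = -1}
    with hAdef
  have hA := measurableSet_minusSelected_offOrigin (d := d) R R'
  have hc' : ∀ η : SpinConfig (Site d), decimate d b η ∈ A →
      isingExpect (zdGraph d) W β h (.fixed η) (spinAt 0) ≤ c := by
    intro η hη
    have hmem : decimate d b (Function.update η 0 1) ∈ minusSelected d R R' := by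
      have hoff : ∀ x : Site d, x ≠ 0 →
          decimate d b (Function.update η 0 1) x = decimate d b η x := by
        intro x hx
        simp only [decimate_apply]
        rw [Function.update_of_ne]
        intro hbx
        apply hx
        funext i
        have := congrFun hbx i
        simp only [Pi.zero_apply, mul_eq_zero, Nat.cast_eq_zero] at this
        exact this.resolve_left hb.ne'
      refine ⟨fun x hx => ?_, fun x hx hxR => ?_⟩
      · by_cases hx0 : x = 0
        · subst hx0
          rw [decimate_apply_zero, Function.update_self, altConfig_zero]
        · rw [hoff x hx0]; exact hη.1 x hx hx0
      · have hx0 : x ≠ 0 := fun h0 => hxR (h0 ▸ zero_mem_box d R)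
        rw [hoff x hx0]; exact hη.2 x hx hxR
    have := hc _ hmem
    rwa [isingExpect_fixed_update_of_mem W β h h0] at this
  have hint : Integrable (spinAt (0 : Site d)) (μ.map (decimate d b)) :=
    (integrable_const (1 : ℝ)).mono' (measurable_spinAt 0).aestronglyMeasurable
      (ae_of_all _ (norm_spinAt_le_one 0))
  have key := ae_condExp_le_of_setIntegral (ν := μ.map (decimate d b)) cylinderEvents_le_pi hint
    hA c (fun B hB hBA => ?_)
  · filter_upwards [key] with ω hω hmem
    exact hω ⟨fun x hx _ => hmem.1 x hx, hmem.2⟩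
  rw [setIntegral_spinAt_map_decimate hμ W hW hB]
  have hpre : MeasurableSet (decimate d b ⁻¹' B) :=
    cylinderEvents_le_pi _ (measurable_decimate_outside W hW hB)
  have hBm : MeasurableSet B := cylinderEvents_le_pi _ hB
  calc ∫ η in decimate d b ⁻¹' B, isingExpect (zdGraph d) W β h (.fixed η) (spinAt 0) ∂μ
      ≤ ∫ _ in decimate d b ⁻¹' B, c ∂μ := by
        refine setIntegral_mono_on ?_ (integrableOn_const (measure_ne_top μ _)) hpre
          fun η hη => hc' η (hBA hη)
        refine ((integrable_const (1 : ℝ)).mono' ?_ (ae_of_all _ fun η => ?_)).integrableOn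
        · exact ((measurable_spinAt 0).stronglyMeasurable.integral_kernel
            (κ := (isSpecification_isingSpecification_zd_holds d β h).piKernel W)).aestronglyMeasurable
        · unfold isingExpect
          simpa using norm_integral_le_of_norm_le_const (μ := isingMeasure (zdGraph d) W β h (.fixed η))
            (ae_of_all _ (norm_spinAt_le_one 0))
    _ = c * μ.real (decimate d b ⁻¹' B) := by rw [setIntegral_const, smul_eq_mul, mul_comm]
    _ = c * (μ.map (decimate d b)).real B := by
        rw [map_measureReal_apply (measurable_decimate d b) hBm]

/-- **van Enter–Fernández–Sokal 1993, eq. (4.32) for decimation with spacing `b`, from the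
finite-volume estimate** (the "Conclusion of the argument" of §4.3.1 as invoked in §4.3.2: "The
conclusions of Theorem 4.2 for decimation with spacing `b = 2` hold also for larger spacings …
Steps 2 and 3 are then proven in a manner exactly identical to the `b = 2` case"). For `d ≥ 2`,
`b ≥ 2`, `β > J₀(d,b)` and every zero-field Ising Gibbs measure `μ`, writing `ν = μT_b`: there is
`δ > 0` such that for every `R` there are `R' > R` and levels `c₊ - c₋ ≥ δ` with
`E_ν(σ'_0 | {σ'_x}_{x≠0}) ≥ c₊` `ν`-a.e. on `𝒩_{R,R',+}` and `≤ c₋` `ν`-a.e. on `𝒩_{R,R',-}` — the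
shape of `VEFS1993_eq432` (there `b = 2`, `d ≥ 3`, `β > β_c(d-1)`). This is the printed Step 0
made rigorous: uniform bounds on `⟨σ_0⟩^η_W` over all boundary conditions `η` with
`T_bη ∈ 𝒩_{R,R',±}` pass to the conditional expectation `E_{μT_b}(σ'_0 | {σ'_x}_{x≠0})` of the
decimation of ANY Gibbs measure `μ` ("we shall have to prove bounds which are valid uniformly for
all Gibbs measures of the restricted interaction", §4.1.2 Step 0). The estimate (4.32) for
spacing `b` is stated here in full as the conclusion (it is not a separate named fact: its whole
content beyond `VEFS1993_eq413_spacing` is this proved transfer); it implies Theorem 4.3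
(`VEFS1993_thm43_of_eq432_spacing`).
[cite: VanenterFernandezSokal1993, §4.3.2, §4.3.1 eq. (4.32), §4.1.2 Step 0 and §4.2 Step 2] -/
theorem VEFS1993_eq432_spacing_of_eq413 (h413 : VEFS1993_eq413_spacing) :
    ∀ d b : ℕ, 2 ≤ d → 2 ≤ b → ∃ J₀ : ℝ, ∀ β : ℝ, J₀ < β →
      ∀ μ ∈ isingGibbsMeasures d β 0, ∃ δ : ℝ, 0 < δ ∧ ∀ R : ℕ, ∃ R' : ℕ, R < R' ∧
        ∃ cplus cminus : ℝ, δ ≤ cplus - cminus ∧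
          (∀ᵐ ω ∂(μ.map (decimate d b)), ω ∈ plusSelected d R R' →
            cplus ≤ condExpSpinAtOrigin d (μ.map (decimate d b)) ω) ∧
          (∀ᵐ ω ∂(μ.map (decimate d b)), ω ∈ minusSelected d R R' →
            condExpSpinAtOrigin d (μ.map (decimate d b)) ω ≤ cminus) := by
  intro d b hd hb
  obtain ⟨J₀, hJ⟩ := h413 d b hd hb
  refine ⟨J₀, fun β hβ μ hμ => ?_⟩
  obtain ⟨δ, hδ, hR⟩ := hJ β hβ
  refine ⟨δ, hδ, fun R => ?_⟩
  obtain ⟨R', hRR', W, h0, hW, cplus, cminus, hgap, hplus, hminus⟩ := hR R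
  have hb0 : 0 < b := by omega
  exact ⟨R', hRR', cplus, cminus, hgap,
    ae_le_condExpSpinAtOrigin_of_forall_isingExpect hb0 hμ h0 hW hplus,
    ae_condExpSpinAtOrigin_le_of_forall_isingExpect hb0 hμ h0 hW hminus⟩

end Transfer

/-! ### Conclusion of the argument: a.e. gaps at `ω'_alt` exclude every Feller specification -/

section Conclusion

variable {d : ℕ}

/-- **The Griffiths–Pearce–Israel conclusion as a general principle** (van Enter–Fernández–Sokal
§4.1.2 p. 101, §4.2 "Conclusion of the argument", §4.3.1 (4.32)): let `ν` be a measure on image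
configurations and suppose there are `δ > 0`, sets `N₊(R)`, `N₋(R)` of configurations all equal
to `ω'_alt` on `Λ_R`, charged by `ν`, and levels `c₊(R) - c₋(R) ≥ δ` with
`E_ν(σ'_0 | {σ'_x}_{x≠0}) ≥ c₊(R)` `ν`-a.e. on `N₊(R)` and `≤ c₋(R)` `ν`-a.e. on `N₋(R)`. Then `ν` is
consistent with no Feller (= quasilocal, finite single-spin space) specification: such a
specification `γ'` would make `γ'_{{0}} σ'_0` a CONTINUOUS version of the conditional expectation
(`IsGibbsMeasure.integral_ae_eq_condExp`), taking values `≥ c₊(R)` and `≤ c₋(R)` at points of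
`N₊(R)`, `N₋(R)`, which converge to `ω'_alt` as `R → ∞` — contradicting continuity at `ω'_alt`.
[cite: VanenterFernandezSokal1993, §4.1.2 p. 101 and §4.2 Conclusion of the argument] -/
theorem not_isQuasilocalMeasure_of_gap {ν : Measure (SpinConfig (Site d))}
    (Np Nm : ℕ → Set (SpinConfig (Site d)))
    (hNp : ∀ R, ∀ ω ∈ Np R, ∀ x ∈ box d R, ω x = altConfig d x)
    (hNm : ∀ R, ∀ ω ∈ Nm R, ∀ x ∈ box d R, ω x = altConfig d x)
    (hposp : ∀ R, ν (Np R) ≠ 0) (hposm : ∀ R, ν (Nm R) ≠ 0)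
    {δ : ℝ} (hδ : 0 < δ) (cp cm : ℕ → ℝ) (hgap : ∀ R, δ ≤ cp R - cm R)
    (hp : ∀ R, ∀ᵐ ω ∂ν, ω ∈ Np R → cp R ≤ condExpSpinAtOrigin d ν ω)
    (hm : ∀ R, ∀ᵐ ω ∂ν, ω ∈ Nm R → condExpSpinAtOrigin d ν ω ≤ cm R) :
    ¬ IsQuasilocalMeasure ν := by
  rintro ⟨γ', hγ', hF, hG⟩
  -- the continuous version of `E_ν(σ'_0 | 𝓕_{0ᶜ})` provided by the Feller specification
  set g : SpinConfig (Site d) → ℝ := fun η => ∫ σ, spinAt 0 σ ∂(γ' {0} η) with hg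
  have hg_cont : Continuous g := hF {0} (spinAtBCF 0)
  have hg_ae : g =ᵐ[ν] condExpSpinAtOrigin d ν :=
    hG.integral_ae_eq_condExp hγ' {0} (measurable_spinAt 0) (norm_spinAt_le_one 0)
  have pts : ∀ R : ℕ, ∃ ω₁ ω₂ : SpinConfig (Site d),
      (∀ x ∈ box d R, ω₁ x = altConfig d x) ∧ (∀ x ∈ box d R, ω₂ x = altConfig d x) ∧
        δ ≤ g ω₁ - g ω₂ := by
    intro R
    have h1 : ∀ᵐ ω ∂ν, ω ∈ Np R → cp R ≤ g ω := by
      filter_upwards [hp R, hg_ae] with ω hω hgω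
      intro hmem
      rw [hgω]
      exact hω hmem
    have h2 : ∀ᵐ ω ∂ν, ω ∈ Nm R → g ω ≤ cm R := by
      filter_upwards [hm R, hg_ae] with ω hω hgω
      intro hmem
      rw [hgω]
      exact hω hmem
    obtain ⟨ω₁, hω₁, hg₁⟩ : ∃ ω ∈ Np R, cp R ≤ g ω := by
      by_contra hcon
      push Not at hcon
      refine hposp R (measure_mono_null (fun ω hω => ?_) (ae_iff.1 h1))
      simp only [Set.mem_setOf_eq, Classical.not_imp, not_le]
      exact ⟨hω, hcon ω hω⟩
    obtain ⟨ω₂, hω₂, hg₂⟩ : ∃ ω ∈ Nm R, g ω ≤ cm R := by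
      by_contra hcon
      push Not at hcon
      refine hposm R (measure_mono_null (fun ω hω => ?_) (ae_iff.1 h2))
      simp only [Set.mem_setOf_eq, Classical.not_imp, not_le]
      exact ⟨hω, hcon ω hω⟩
    exact ⟨ω₁, ω₂, hNp R ω₁ hω₁, hNm R ω₂ hω₂, by linarith [hgap R]⟩
  choose ω₁ ω₂ h₁ h₂ hgap' using pts
  have t₁ : Tendsto (fun R => g (ω₁ R)) atTop (𝓝 (g (altConfig d))) :=
    (hg_cont.tendsto _).comp (tendsto_altConfig_of_eqOn_box h₁)
  have t₂ : Tendsto (fun R => g (ω₂ R)) atTop (𝓝 (g (altConfig d))) :=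
    (hg_cont.tendsto _).comp (tendsto_altConfig_of_eqOn_box h₂)
  have t : Tendsto (fun R => g (ω₁ R) - g (ω₂ R)) atTop (𝓝 0) := by
    simpa using t₁.sub t₂
  obtain ⟨R, hR⟩ := (t.eventually (Iio_mem_nhds hδ)).exists
  exact absurd (hgap' R) (not_le.2 hR)

/-- **(4.32) at one decimated Gibbs measure excludes every quasilocal specification** ("As in
the 2-dimensional case, this implies the non-quasilocality of the renormalized measure `μT`, for
any original Gibbs measure `μ`", §4.3.1–§4.3.2), for spacing `b ≥ 1` and any `(β, h)`: if
`ν = μT_b` has, for some `δ > 0` and every `R`, an `R' > R` and levels `c₊ - c₋ ≥ δ` with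
`E_ν(σ'_0 | {σ'_x}_{x≠0}) ≥ c₊` `ν`-a.e. on `𝒩_{R,R',+}` and `≤ c₋` `ν`-a.e. on `𝒩_{R,R',-}`, then
`ν` is not quasilocal — the sets `𝒩_{R,R',±}` have positive `μT_b`-measure
(`map_decimate_plusSelected_pos_spacing`) and shrink to `ω'_alt`, so
`not_isQuasilocalMeasure_of_gap` applies.
[cite: VanenterFernandezSokal1993, §4.3.1 eq. (4.32) and Conclusion of the argument] -/
theorem not_isQuasilocalMeasure_map_decimate_of_gap {b : ℕ} (hb : 0 < b) {β h : ℝ}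
    {μ : Measure (SpinConfig (Site d))} (hμ : μ ∈ isingGibbsMeasures d β h) {δ : ℝ} (hδ : 0 < δ)
    (hR : ∀ R : ℕ, ∃ R' : ℕ, R < R' ∧ ∃ cplus cminus : ℝ, δ ≤ cplus - cminus ∧
      (∀ᵐ ω ∂(μ.map (decimate d b)), ω ∈ plusSelected d R R' →
        cplus ≤ condExpSpinAtOrigin d (μ.map (decimate d b)) ω) ∧
      (∀ᵐ ω ∂(μ.map (decimate d b)), ω ∈ minusSelected d R R' →
        condExpSpinAtOrigin d (μ.map (decimate d b)) ω ≤ cminus)) :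
    ¬ IsQuasilocalMeasure (μ.map (decimate d b)) := by
  choose R' _ cplus cminus hgap hplus hminus using hR
  exact not_isQuasilocalMeasure_of_gap (fun R => plusSelected d R (R' R))
    (fun R => minusSelected d R (R' R)) (fun R ω hω => eqOn_box_of_mem_plusSelected hω)
    (fun R ω hω => eqOn_box_of_mem_minusSelected hω)
    (fun R => (map_decimate_plusSelected_pos_spacing hb hμ R (R' R)).ne')
    (fun R => (map_decimate_minusSelected_pos_spacing hb hμ R (R' R)).ne') hδ cplus cminus hgap
    hplus hminus

/-- **Reduction of Theorem 4.3 to the estimate (4.32) for spacing `b`** (§4.3.2 with the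
Conclusion of the argument of §4.3.1): the estimate (4.32) for spacing `b` — the explicit
conclusion of `VEFS1993_eq432_spacing_of_eq413`, taken here as the hypothesis — gives Theorem 4.3
measure by measure (`not_isQuasilocalMeasure_map_decimate_of_gap`).
[cite: VanenterFernandezSokal1993, Theorem 4.3 and §4.3.1 eq. (4.32)] -/
theorem VEFS1993_thm43_of_eq432_spacing
    (h432 : ∀ d b : ℕ, 2 ≤ d → 2 ≤ b → ∃ J₀ : ℝ, ∀ β : ℝ, J₀ < β →
      ∀ μ ∈ isingGibbsMeasures d β 0, ∃ δ : ℝ, 0 < δ ∧ ∀ R : ℕ, ∃ R' : ℕ, R < R' ∧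
        ∃ cplus cminus : ℝ, δ ≤ cplus - cminus ∧
          (∀ᵐ ω ∂(μ.map (decimate d b)), ω ∈ plusSelected d R R' →
            cplus ≤ condExpSpinAtOrigin d (μ.map (decimate d b)) ω) ∧
          (∀ᵐ ω ∂(μ.map (decimate d b)), ω ∈ minusSelected d R R' →
            condExpSpinAtOrigin d (μ.map (decimate d b)) ω ≤ cminus)) :
    VEFS1993_thm43 := by
  intro d b hd hb
  obtain ⟨J₀, hJ⟩ := h432 d b hd hb
  refine ⟨J₀, fun β hβ μ hμ => ?_⟩
  have hb0 : 0 < b := by omega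
  obtain ⟨δ, hδ, hR⟩ := hJ β hβ μ hμ
  exact not_isQuasilocalMeasure_map_decimate_of_gap hb0 hμ hδ hR

/-- **Theorem 4.3 from the uniform finite-volume estimate** (the assembly of this file): Steps 1–3
of §4.3.2 in finite volume (`VEFS1993_eq413_spacing`, the named fact) ⟹ (4.32) for spacing `b`
(`VEFS1993_eq432_spacing_of_eq413`, proved) ⟹ Theorem 4.3 (`VEFS1993_thm43_of_eq432_spacing`,
proved). What remains for `VEFS1993_thm43_holds` is exactly `VEFS1993_eq413_spacing`.
[cite: VanenterFernandezSokal1993, Theorem 4.3] -/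
theorem VEFS1993_thm43_of_eq413 (h413 : VEFS1993_eq413_spacing) : VEFS1993_thm43 :=
  VEFS1993_thm43_of_eq432_spacing (VEFS1993_eq432_spacing_of_eq413 h413)

/-- Under the finite-volume estimate, for every `d ≥ 2`, `b ≥ 2` there is a threshold beyond which
the spacing-`b` decimation step does not act on Hamiltonians at `(β, 0)` (the technique class
`RenormalizedHamiltonianExists` fails). [cite: VanenterFernandezSokal1993, Theorem 4.3 and Definition 3.1] -/
theorem exists_not_renormalizedHamiltonianExists_of_eq413 (h413 : VEFS1993_eq413_spacing)
    {d b : ℕ} (hd : 2 ≤ d) (hb : 2 ≤ b) :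
    ∃ J₀ : ℝ, ∀ β : ℝ, J₀ < β → ¬ RenormalizedHamiltonianExists d (decimate d b) β 0 :=
  exists_not_renormalizedHamiltonianExists_of_thm43 (VEFS1993_thm43_of_eq413 h413) hd hb

end Conclusion

end Literature.Barriers.CriticalPhenomena.NonGibbs

end
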